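import Summits.QuantumFields.YangMills.Theses.ColdStartUniversality
import Summits.QuantumFields.YangMills.Theorems.ColdStartUniversalityUniformColdStartMixingFixedCutoffEntropy
import HarnessLib

/-!
# Crux K_A1 `UniformColdStartMixing` (stmt-QuantumFields-24809, ASIDE) — LINE 4 «cold_entropy», plan-only rung
# `stub_fixedCutoffEntropy` (BC5), `Lines/rung_fixedCutoffEntropy.lean`, v1 (seat `ym-line-csu-p1`, g10, 2026-08-29): CLOSED

NOT a registered skeleton (the K_A1 body is untouched; the line's K-UNIFORM nodes `stub_coldEntropyBudget`, `stub_entropyDissipation`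
stay open).  The rung = the line's entropy functional exercised at ONE cut-off: the cold-start law of the SU(2) SZZ dynamics at
`β' = (γ ε_K)⁻¹/2` has relative entropy `≤ H₀` w.r.t. Bałaban's step-`K` Gibbs measure at physical time `s₀ = ε_K`, and `≤ η` at all
times `s ≥ s₀ + T(η)` — now the SORRY-FREE tree theorem
`Summit.QuantumFields.YangMills.Theorems.ColdStartUniversality.fixedCutoffEntropy`
(`Theorems/ColdStartUniversalityUniformColdStartMixingFixedCutoffEntropy.lean`), by
* uniform exponential mixing at fixed cut-off `exp_mixing_szz` (Harris with `V ≡ 1`: `chapmanKolmogorov_szz` + `doeblin_szz` (g7) +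
  SZZ Lemma 3.3 `wilsonMeasureLangevinInvariant_su2` (g8)) — `Theorems/ColdStartUniversalityLatticeLangevinExpMixing.lean`;
* the uniform-in-time density bound `map_le_smul_haar_of_le` (g9) read against the Wilson measure, `map_le_smul_wilsonMeasure_of_le`;
* the measure-level Gibbs dictionary `gibbsMeasure_eq_map_wilsonMeasure`;
* elementary entropy lemmas under a one-sided density bound (`Theorems/ColdStartUniversalityKLDivDensityBound.lean`):
  `KL(ν‖μ) = ∫ klFun(dν/dμ) dμ`, `klFun x ≤ max(1, log D)|x − 1|` on `[0, D]` ⇒ budget `max(1, log D)(D+1)` and decay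
  `KL ≤ max(1, log D) · sup_{|g| ≤ 1} (∫ g dν − ∫ g dμ)`.
No log-Sobolev inequality, no named fact, no sorry.  RECORD-rung R3 plumbing; NOT the K-uniform crux K_A1, NOT the mass gap.
-/

set_option autoImplicit false

noncomputable section

namespace Summit.QuantumFields.YangMills.Cruxes.UniformColdStartMixing.RungFixedCutoffEntropy

open MeasureTheory ProbabilityTheory InformationTheory
open scoped NNReal ENNReal
open Literature.MathematicalPhysics.QuantumFieldTheory
open Literature.MathematicalPhysics.QuantumLattice (fundamentalRep fundamentalLatticeRep continuous_fundamentalRep)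
open Literature.MathematicalPhysics.QuantumFieldTheory.Balaban1983to89
open Summit.QuantumFields.YangMills.Theorems.ColdStartUniversality

/-- **The rung `stub_fixedCutoffEntropy`** (node `FixedCutoffEntropy` of `Lines_cold_entropy.lean`, local abbreviations unfolded),
sorry-free: the tree theorem `fixedCutoffEntropy`. -/
theorem stub_fixedCutoffEntropy :
    ∀ (F : T3ContinuumYM3Torus.T3Family) (γ : ℝ), 0 < γ → ∀ K : ℕ,
      ∃ s₀ H₀ : ℝ, 0 < s₀ ∧ 0 ≤ H₀ ∧
        ∀ η : ℝ, 0 < η → ∃ T : ℝ, 0 < T ∧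
          ∀ (Ω : Type) (mΩ : MeasurableSpace Ω) (P : Measure Ω) (_ : IsProbabilityMeasure P)
            (W : ℝ≥0 → Ω → (Edge 3 ((F.P K).sitesPerDir 0) × NoiseIdx 2 → ℝ)) (hW : IsFlatBrownian W P)
            (U : ℝ≥0 → Ω → GaugeConfig 3 ((F.P K).sitesPerDir 0) (Matrix.specialUnitaryGroup (Fin 2) ℂ)),
            ((∀ ω, U 0 ω = fun _ => 1) ∧
              (latticeLangevinDynamics (⟨2, fundamentalRep (Fin 2), continuous_fundamentalRep _,
                  Literature.MathematicalPhysics.QuantumLattice.fundamentalRep_injective _,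
                  Literature.MathematicalPhysics.QuantumLattice.fundamentalRep_mem_unitaryGroup⟩ :
                  LatticeRep (Matrix.specialUnitaryGroup (Fin 2) ℂ)) ((γ * (F.P K).eps)⁻¹ / 2)).IsSolution
                (fundamentalRep (Fin 2)) hW.natFiltration P W U) →
            klDiv (Measure.map (fun ω => (fun b : PBond (F.P K) 0 => U (s₀ / (F.P K).eps).toNNReal ω (b.src, b.dir) :
                  GaugeField (F.P K) 0 (Matrix.specialUnitaryGroup (Fin 2) ℂ))) P)
                (T4GenFunBounds.gibbsMeasure (F.P K)
                  ((F.scheme (ExpMeanLog.expMeanLogSU : LoopAverage (Matrix.specialUnitaryGroup (Fin 2) ℂ)) γ).β K))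
              ≤ ENNReal.ofReal H₀ ∧
            ∀ s : ℝ, s₀ + T ≤ s →
              klDiv (Measure.map (fun ω => (fun b : PBond (F.P K) 0 => U (s / (F.P K).eps).toNNReal ω (b.src, b.dir) :
                    GaugeField (F.P K) 0 (Matrix.specialUnitaryGroup (Fin 2) ℂ))) P)
                  (T4GenFunBounds.gibbsMeasure (F.P K)
                    ((F.scheme (ExpMeanLog.expMeanLogSU : LoopAverage (Matrix.specialUnitaryGroup (Fin 2) ℂ)) γ).β K))
                ≤ ENNReal.ofReal η :=
  fixedCutoffEntropy

end Summit.QuantumFields.YangMills.Cruxes.UniformColdStartMixing.RungFixedCutoffEntropy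

end
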